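import Summits.MatrixMultiplication.MatrixMultiplication.Theorems.SnLevelDesigns.Negative.DimensionWalls
import Literature.RepresentationTheory.FiniteGroups.SymmetricGroupCosetSpanProofs
import Literature.NumberTheory.DiophantineGeometry.SymmetricGroupRepsFinrankSpechtProofs
import Literature.NumberTheory.DiophantineGeometry.SymmetricGroupRepsCompletenessProofs

/-!
# Route `LevelGradedCohnUmans`, item stmt-MatrixMultiplication-7616 `TokenWall`

The upper wall of the level-`k` window: if `X, Y, Z ⊆ 𝔖ₙ` are `k`-token separated and `Z ≠ ∅`,
then `|X|·|Y| ≤ ∑_{μ ⊢ n, μ₁ ≥ n - k} (f^μ)²`.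

Proof (three inequalities):

* `|X|·|Y| ≤ dim T_k` — the right translates `g ↦ f_{x, z₁}(g · y⁻¹ z₁)` of the separators of one
  column `z₁ ∈ Z` are `|X|·|Y|` linearly independent `k`-token functions (dual points `x⁻¹ y`);
  in tree: `SnLevelDesigns.Negative.card_X_mul_card_Y_le_finrank` (`DimensionWalls.lean`).
* `T_k ≤ V_k` (`tokenSpace_le_efpV`): a token function `g ↦ ∑_p c p (g ∘ p)` is a combination of
  indicators `1[g ∘ p = q]` (`p q : Fin k → Fin n`, not necessarily injective), and the group-algebra
  element `∑_{σ ∘ p = q} σ = [Fix (im q)] · π` kills every Specht module `S^μ = ℂ[𝔖ₙ] a_μ b_μ` with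
  `μ₁ < n - k ≤ n - |im q|` by the pigeonhole/transposition trick already in the tree
  (`EllisFriedgutPilpel2011.fixSum_mul_mul_colAntisymmetrizer_eq_zero`, Ellis–Friedgut–Pilpel 2011,
  proof of Thm. 7, first half).
* `dim V_k ≤ ∑_{μ₁ ≥ n-k} (dim S^μ)² = ∑_{μ₁ ≥ n-k} (f^μ)²` (`finrank_efpV_le`): the map
  `f ↦ (f̂([μ]))_{μ₁ ≥ n-k}`, `V_k → ⊕ End(S^μ)`, is injective, because an element of `ℂ[𝔖ₙ]`
  killing every Specht module kills every minimal left ideal (completeness of the Specht modules,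
  `exists_equiv_spechtRep_of_isIrreducible_holds`), hence all of `ℂ[𝔖ₙ]` (Maschke,
  `IsSemisimpleModule.sSup_simples_eq_top`), hence is `0` (`eq_zero_of_forall_fourierSpecht_eq_zero`);
  and `dim S^μ = f^μ` (`finrank_spechtIdeal_holds`).

Only the inequality `dim T_k ≤ ∑_{μ₁ ≥ n-k} (f^μ)²` is proved here (all the item needs); equality
(Schensted's count via EFP Thm. 7 and Wedderburn) is not.
-/

noncomputable section

open scoped BigOperators

namespace Summit.MatrixMultiplication.MatrixMultiplication.Theorems

open Literature.NumberTheory.DiophantineGeometry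
open Literature.RepresentationTheory.FiniteGroups

namespace LevelGradedCohnUmansTokenWall

variable {n k : ℕ}

/-! ### `T_k ≤ V_k`: token functions have Fourier support on `μ₁ ≥ n - k` -/

/-- The sum of the permutations `σ` with `σ ∘ p = q` is a right translate of a pointwise-stabiliser
sum: `∑_{σ ∘ p = q} σ = [Fix (im q)] · π` for any `π` with `π ∘ p = q` (for not necessarily
injective `p q : Fin k → Fin n`; companion of `EllisFriedgutPilpel2011.cosetSum_eq_fixSum_mul_of`). -/
theorem filterSum_eq_fixSum_mul_of (p q : Fin k → Fin n) {π : Equiv.Perm (Fin n)}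
    (hπ : ∀ i, π (p i) = q i) :
    ∑ σ ∈ Finset.univ.filter (fun σ : Equiv.Perm (Fin n) => ∀ i, σ (p i) = q i),
        MonoidAlgebra.of ℂ _ σ =
      (∑ σ ∈ Finset.univ.filter
          (fun σ : Equiv.Perm (Fin n) => ∀ x ∈ Finset.univ.image q, σ x = x),
        MonoidAlgebra.of ℂ _ σ) * MonoidAlgebra.of ℂ _ π := by
  rw [Finset.sum_mul]
  symm
  refine Finset.sum_equiv (Equiv.mulRight π) (fun σ => ?_) (fun σ _ => ?_)
  · simp only [Equiv.coe_mulRight, Finset.mem_filter, Finset.mem_univ, true_and,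
      Equiv.Perm.mul_apply, hπ]
    constructor
    · intro h i
      exact h (q i) (Finset.mem_image_of_mem q (Finset.mem_univ i))
    · intro h x hx
      obtain ⟨i, -, rfl⟩ := Finset.mem_image.1 hx
      exact h i
  · rw [Equiv.coe_mulRight, map_mul]

/-- The indicator of `{σ | σ ∘ p = q}` lies in `V_k` for all `p q : Fin k → Fin n`: its Fourier
transform at `[μ]` is left multiplication by `[Fix (im q)] · π` on `S^μ = ℂ[𝔖ₙ] a_μ b_μ`, and
`[Fix C] · x · b_μ = 0` whenever `μ₁ < n - |C|` (here `|im q| ≤ k`), by the transposition trick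
(`EllisFriedgutPilpel2011.fixSum_mul_mul_colAntisymmetrizer_eq_zero`). -/
theorem indicator_comp_mem_efpV (p q : Fin k → Fin n) :
    (fun g : Equiv.Perm (Fin n) => if (⇑g ∘ p) = q then (1 : ℂ) else 0) ∈ efpV n k := by
  rw [mem_efpV_iff]
  intro μ hμ
  apply LinearMap.ext
  intro w
  apply Subtype.ext
  rw [EllisFriedgutPilpel2011.coe_fourierSpecht_apply, LinearMap.zero_apply, Submodule.coe_zero]
  have hsum : ∑ σ : Equiv.Perm (Fin n), (if (⇑σ ∘ p) = q then (1 : ℂ) else 0) •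
      MonoidAlgebra.of ℂ _ σ =
      ∑ σ ∈ Finset.univ.filter (fun σ : Equiv.Perm (Fin n) => ∀ i, σ (p i) = q i),
        MonoidAlgebra.of ℂ _ σ := by
    rw [Finset.sum_filter]
    refine Finset.sum_congr rfl fun σ _ => ?_
    by_cases h : (⇑σ ∘ p) = q
    · rw [if_pos h, if_pos (show ∀ i, σ (p i) = q i from fun i => congrFun h i), one_smul]
    · rw [if_neg h, if_neg (show ¬ ∀ i, σ (p i) = q i from fun h' => h (funext h')), zero_smul]
  rw [hsum]
  by_cases hT : ∃ π : Equiv.Perm (Fin n), ∀ i, π (p i) = q i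
  · obtain ⟨π, hπ⟩ := hT
    obtain ⟨y, hy⟩ := Ideal.mem_span_singleton'.1 w.2
    have hCk : (Finset.univ.image q).card ≤ k :=
      Finset.card_image_le.trans (by rw [Finset.card_univ, Fintype.card_fin])
    have hC : μ.parts.sup < n - (Finset.univ.image q).card :=
      lt_of_lt_of_le hμ (Nat.sub_le_sub_left hCk n)
    have h0 := EllisFriedgutPilpel2011.fixSum_mul_mul_colAntisymmetrizer_eq_zero
      (Finset.univ.image q) hC (MonoidAlgebra.of ℂ _ π * y * rowSymmetrizer ℂ μ)
    rw [filterSum_eq_fixSum_mul_of p q hπ, ← hy]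
    simp only [youngSymmetrizer, mul_assoc] at h0 ⊢
    exact h0
  · have hempty : Finset.univ.filter (fun σ : Equiv.Perm (Fin n) => ∀ i, σ (p i) = q i) = ∅ :=
      Finset.filter_eq_empty_iff.2 fun σ _ h => hT ⟨σ, h⟩
    rw [hempty, Finset.sum_empty, zero_mul]

/-- A token function is a combination of indicators of the fibres `{g | g ∘ p = q}`:
`∑_p c p (g ∘ p) = ∑_p ∑_q c p q · 1[g ∘ p = q]`. -/
theorem tokenFn_eq_sum (c : (Fin k → Fin n) → (Fin k → Fin n) → ℂ) :
    SnLevelDesigns.Negative.tokenFn c =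
      ∑ p : Fin k → Fin n, ∑ q : Fin k → Fin n,
        c p q • (fun g : Equiv.Perm (Fin n) => if (⇑g ∘ p) = q then (1 : ℂ) else 0) := by
  funext g
  simp only [SnLevelDesigns.Negative.tokenFn, Finset.sum_apply, Pi.smul_apply, smul_eq_mul,
    mul_ite, mul_one, mul_zero]
  refine Finset.sum_congr rfl fun p _ => ?_
  rw [Finset.sum_ite_eq, if_pos (Finset.mem_univ _)]

/-- **`T_k ≤ V_k`**: the `k`-token test space has Fourier support on the `[μ]` with `μ₁ ≥ n - k`
(Ellis–Friedgut–Pilpel 2011, proof of Thm. 7, first half, extended from `k`-cosets to all fibres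
`{g | g ∘ p = q}` of possibly non-injective `p`). -/
theorem tokenSpace_le_efpV (n k : ℕ) : SnLevelDesigns.Negative.tokenSpace n k ≤ efpV n k := by
  rintro _ ⟨c, rfl⟩
  change SnLevelDesigns.Negative.tokenFn c ∈ efpV n k
  rw [tokenFn_eq_sum]
  exact Submodule.sum_mem _ fun p _ => Submodule.sum_mem _ fun q _ =>
    Submodule.smul_mem _ _ (indicator_comp_mem_efpV p q)

/-! ### Fourier injectivity on `ℂ[𝔖ₙ]` and the dimension of `V_k` -/

/-- **Injectivity of the Fourier transform on the Specht modules**: a function on `𝔖ₙ` whose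
Fourier transform `f̂([μ]) = ∑_σ f(σ) ρ_μ(σ)` vanishes at every `[μ]`, `μ ⊢ n`, is zero.
`z_f = ∑_σ f(σ) σ` kills every `S^μ`, hence every minimal left ideal of `ℂ[𝔖ₙ]` (each is `≅ S^μ`
for some `μ`, completeness of the Specht modules), hence `ℂ[𝔖ₙ] = ∑ (minimal left ideals)`
(Maschke), so `z_f = z_f · 1 = 0`. -/
theorem eq_zero_of_forall_fourierSpecht_eq_zero (f : Equiv.Perm (Fin n) → ℂ)
    (hf : ∀ μ : Nat.Partition n, fourierSpecht f μ = 0) : f = 0 := by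
  classical
  set z : MonoidAlgebra ℂ (Equiv.Perm (Fin n)) :=
    ∑ σ : Equiv.Perm (Fin n), f σ • MonoidAlgebra.of ℂ _ σ with hzdef
  -- `z` kills every Specht module
  have hz : ∀ (μ : Nat.Partition n) (w : spechtIdeal ℂ μ), z • w = 0 := by
    intro μ w
    apply Subtype.ext
    rw [Submodule.coe_smul, smul_eq_mul, hzdef, ← EllisFriedgutPilpel2011.coe_fourierSpecht_apply,
      hf μ, LinearMap.zero_apply, Submodule.coe_zero]
  -- it suffices that `z = 0`
  suffices hz0 : z = 0 by
    funext τ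
    have hcoeff := EllisFriedgutPilpel2011.coeff_sum_smul_of f τ
    rw [← hzdef, hz0, MonoidAlgebra.coeff_zero, Finsupp.zero_apply] at hcoeff
    rw [Pi.zero_apply, ← hcoeff]
  -- Maschke: `ℂ[𝔖ₙ]` is the sum of its minimal left ideals
  haveI : NeZero (Nat.card (Equiv.Perm (Fin n)) : ℂ) := ⟨Nat.cast_ne_zero.2 Nat.card_pos.ne'⟩
  set S : Set (Submodule (MonoidAlgebra ℂ (Equiv.Perm (Fin n)))
      (MonoidAlgebra ℂ (Equiv.Perm (Fin n)))) :=
    {m | IsSimpleModule (MonoidAlgebra ℂ (Equiv.Perm (Fin n))) m} with hS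
  have h1 : (1 : MonoidAlgebra ℂ (Equiv.Perm (Fin n))) ∈
      ⨆ m : S, (m : Submodule (MonoidAlgebra ℂ (Equiv.Perm (Fin n)))
        (MonoidAlgebra ℂ (Equiv.Perm (Fin n)))) := by
    rw [← sSup_eq_iSup', hS, IsSemisimpleModule.sSup_simples_eq_top]
    exact Submodule.mem_top
  -- each minimal left ideal is killed by `z`
  have key : ∀ m : S, ∀ x ∈ (m : Submodule (MonoidAlgebra ℂ (Equiv.Perm (Fin n)))
      (MonoidAlgebra ℂ (Equiv.Perm (Fin n)))), z * x = 0 := by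
    rintro ⟨m, hm⟩ x hx
    simp only [hS, Set.mem_setOf_eq] at hm
    change x ∈ m at hx
    haveI := hm
    haveI : FiniteDimensional ℂ m :=
      Module.Finite.of_injective (m.subtype.restrictScalars ℂ) Subtype.val_injective
    -- the irreducible representation on `m`, and `m ≅ S^μ`
    let ρm : Representation ℂ (Equiv.Perm (Fin n)) m :=
      Representation.ofModule' (k := ℂ) (G := Equiv.Perm (Fin n)) m
    let em : ρm.asModule ≃ₗ[MonoidAlgebra ℂ (Equiv.Perm (Fin n))] m :=
      { toFun := ρm.asModuleEquiv
        invFun := ρm.asModuleEquiv.symm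
        map_add' := map_add _
        map_smul' := fun x w => by
          rw [Representation.asModuleEquiv_map_smul, asAlgebraHom_ofModule', Algebra.lsmul_coe]
          rfl
        left_inv := ρm.asModuleEquiv.left_inv
        right_inv := ρm.asModuleEquiv.right_inv }
    haveI : ρm.IsIrreducible := by
      rw [Representation.irreducible_iff_isSimpleModule_asModule]
      exact IsSimpleModule.congr em
    obtain ⟨μ, ⟨e⟩⟩ := exists_equiv_spechtRep_of_isIrreducible_holds (k := ℂ) ρm
    have hρm : ∀ (g : Equiv.Perm (Fin n)) (v : m),
        ρm g v = MonoidAlgebra.of ℂ (Equiv.Perm (Fin n)) g • v := fun g v => by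
      rw [MonoidAlgebra.of_apply]
      exact ofModule'_apply (k := ℂ) m g v
    have hsp : ∀ (g : Equiv.Perm (Fin n)) (v : spechtIdeal ℂ μ),
        spechtRep ℂ μ g v = MonoidAlgebra.of ℂ (Equiv.Perm (Fin n)) g • v :=
      fun g v => Subtype.ext (by rw [spechtRep_apply, Submodule.coe_smul, smul_eq_mul])
    -- `z` kills `S^μ`, hence `m`
    have hxm : z • (⟨x, hx⟩ : m) = 0 := by
      apply EquivLike.injective e
      have h := EllisFriedgutPilpel2011.intertwiningMap_map_smul hρm hsp e.toIntertwiningMap z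
        ⟨x, hx⟩
      rw [Representation.Equiv.coe_toIntertwiningMap] at h
      rw [map_zero, h, hz μ]
    have h0 := congrArg Subtype.val hxm
    simpa only [Submodule.coe_smul, smul_eq_mul, Submodule.coe_zero] using h0
  -- conclude: `z = z · 1 = 0`
  have h := Submodule.iSup_induction
    (fun m : S => (m : Submodule (MonoidAlgebra ℂ (Equiv.Perm (Fin n)))
      (MonoidAlgebra ℂ (Equiv.Perm (Fin n)))))
    (motive := fun x => z * x = 0) h1 key
    (mul_zero z)
    (fun x y hx hy => by rw [mul_add, hx, hy, add_zero])
  rwa [mul_one] at h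

/-- **`dim V_k ≤ ∑_{μ₁ ≥ n-k} (f^μ)²`**: `f ↦ (f̂([μ]))_{μ₁ ≥ n-k}` maps `V_k` injectively into
`⊕_{μ₁ ≥ n-k} End(S^μ)` (on `V_k` the remaining Fourier coefficients vanish by definition, so the
kernel is zero by `eq_zero_of_forall_fourierSpecht_eq_zero`), and `dim End(S^μ) = (f^μ)²`
(`finrank_spechtIdeal_holds`). -/
theorem finrank_efpV_le (n k : ℕ) :
    Module.finrank ℂ (efpV n k) ≤
      ∑ μ : Nat.Partition n,
        if n - k ≤ μ.parts.sup then numStandardTableaux μ ^ 2 else 0 := by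
  classical
  haveI : ∀ μ : Nat.Partition n, Module.Finite ℂ (spechtIdeal ℂ μ) := fun μ =>
    Module.Finite.of_injective ((spechtIdeal ℂ μ).subtype.restrictScalars ℂ) Subtype.val_injective
  let I := {μ : Nat.Partition n // n - k ≤ μ.parts.sup}
  let Φ : efpV n k →ₗ[ℂ] ((μ : I) → Module.End ℂ (spechtIdeal ℂ μ.1)) :=
    { toFun := fun f μ => fourierSpecht (f : Equiv.Perm (Fin n) → ℂ) μ.1
      map_add' := fun f g => by
        funext μ
        simp only [Submodule.coe_add, Pi.add_apply, fourierSpecht_add]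
      map_smul' := fun c f => by
        funext μ
        simp only [Submodule.coe_smul, Pi.smul_apply, fourierSpecht_smul, RingHom.id_apply] }
  have hinj : Function.Injective Φ := by
    rw [injective_iff_map_eq_zero]
    intro f hf0
    apply Subtype.ext
    refine eq_zero_of_forall_fourierSpecht_eq_zero _ fun μ => ?_
    by_cases hμ : n - k ≤ μ.parts.sup
    · exact congrFun hf0 ⟨μ, hμ⟩
    · exact (mem_efpV_iff _).1 f.2 μ (not_le.mp hμ)
  calc Module.finrank ℂ (efpV n k)
      ≤ Module.finrank ℂ ((μ : I) → Module.End ℂ (spechtIdeal ℂ μ.1)) :=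
        LinearMap.finrank_le_finrank_of_injective hinj
    _ = ∑ μ : I, Module.finrank ℂ (Module.End ℂ (spechtIdeal ℂ μ.1)) :=
        Module.finrank_pi_fintype ℂ
    _ = ∑ μ : I, numStandardTableaux μ.1 ^ 2 := by
        refine Finset.sum_congr rfl fun μ _ => ?_
        rw [Module.finrank_linearMap, finrank_spechtIdeal_holds ℂ μ.1, sq]
    _ = ∑ μ ∈ Finset.univ.filter (fun μ : Nat.Partition n => n - k ≤ μ.parts.sup),
          numStandardTableaux μ ^ 2 :=
        (Finset.sum_subtype (Finset.univ.filter fun μ : Nat.Partition n => n - k ≤ μ.parts.sup)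
          (fun μ => by simp only [Finset.mem_filter, Finset.mem_univ, true_and])
          (fun μ : Nat.Partition n => numStandardTableaux μ ^ 2)).symm
    _ = ∑ μ : Nat.Partition n,
          if n - k ≤ μ.parts.sup then numStandardTableaux μ ^ 2 else 0 :=
        Finset.sum_filter _ _

/-- **`dim T_k ≤ ∑_{μ₁ ≥ n-k} (f^μ)²`** (the half of Schensted's/EFP's count
`dim T_k = ∑_{μ₁ ≥ n-k} (f^μ)²` that the wall needs). -/
theorem finrank_tokenSpace_le (n k : ℕ) :
    Module.finrank ℂ (SnLevelDesigns.Negative.tokenSpace n k) ≤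
      ∑ μ : Nat.Partition n,
        if n - k ≤ μ.parts.sup then numStandardTableaux μ ^ 2 else 0 :=
  (Submodule.finrank_mono (tokenSpace_le_efpV n k)).trans (finrank_efpV_le n k)

end LevelGradedCohnUmansTokenWall

/-- **Item stmt-MatrixMultiplication-7616** (`TokenWall`, route `LevelGradedCohnUmans`): if
`X, Y, Z ⊆ 𝔖ₙ` are `k`-token separated and `Z ≠ ∅` then
`|X|·|Y| ≤ ∑_{μ ⊢ n, n - k ≤ μ₁} (f^μ)²`. The right translates of the separators of one column
`z₁ ∈ Z` are `|X|·|Y|` independent token functions (`card_X_mul_card_Y_le_finrank`, tree), the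
token space lies in EFP's `V_k` (`tokenSpace_le_efpV`), and `dim V_k ≤ ∑_{μ₁ ≥ n-k} (f^μ)²`
(`finrank_efpV_le`). -/
theorem tokenWall_proof :
    Summit.MatrixMultiplication.MatrixMultiplication.Theses.LevelGradedCohnUmans.TokenWall := by
  unfold Summit.MatrixMultiplication.MatrixMultiplication.Theses.LevelGradedCohnUmans.TokenWall
  intro n k X Y Z hsep hZ
  exact (SnLevelDesigns.Negative.card_X_mul_card_Y_le_finrank hsep hZ).trans
    (LevelGradedCohnUmansTokenWall.finrank_tokenSpace_le n k)

end Summit.MatrixMultiplication.MatrixMultiplication.Theorems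

end
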